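import Summits.BirchSwinnertonDyer.BirchSwinnertonDyer.Theorems.AlignedTransportAtTwoMainConjectureTransportAlignedAtTwoSdFold
import Literature.NumberTheory.EllipticCurves.NeronIsogenyScalingHoldsProofs
import HarnessLib

/-!
# Crux C1 `MainConjectureTransportAlignedAtTwo` (stmt-BirchSwinnertonDyer-22296), line `birth`: THE NÉRON-SCALING INPUT `hNS` IS A TREE THEOREM —
# T4 (odd Manin constants) from TWO print facts, the `Δ > 0` residual (R1) from FOUR, the v25 bundle `T1⁺ ∧ Néron` from T1⁺ alone
# (width seat att-p4 g15; `--supports 22296`)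

THEOREMS ONLY (no `def`, no `sorry`, no new named fact). BSD is not proved by this; C1 is not closed by this; no registered stub is discharged outright.

Second fold after `…SdFold` (Hecke self-duality, p676260). The T4 discharge of att-p4 g13
(`…DeltaPosOddManin.exists_datum_odd_maninConstant hmod hNS hΩu`, p670841: every curve of the cell has a parametrisation datum at its conductor level with ODD
Manin constant) and everything downstream of it (`…DeltaPosCongruenceLevelOfFacts.lamLawDeltaPos_of_facts`, p671200; `…DeltaPosCongruenceOfFacts`, p671167;
`…SdFold`, p676260; both v25 skeleton proposals in `Cruxes/MainConjectureTransportAlignedAtTwo/Lines/`, whose new PRINT bundle is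
`nonempty_modularJacobianGaloisDataWithForms ∧ integral_neronScaling_of_isGloballyMinimal`) take the Néron mapping property
`hNS : integral_neronScaling_of_isGloballyMinimal` (Silverman ATAEC IV.5.1/IV.6.1/Cor. IV.9.1: the scaling of a rational isogeny between globally minimal models
is an integer) as a hypothesis. That statement is PROVED in the tree: `Literature.NumberTheory.EllipticCurves.integral_neronScaling_of_isGloballyMinimal_holds`
(`Literature/…/NeronIsogenyScalingHoldsProofs.lean`, an elementary point count over unramified layers replacing Néron models). This file folds it:

* `galoisFormsAndNeronAtTwo_of_forms hJ : nonempty_modularJacobianGaloisDataWithForms ∧ integral_neronScaling_of_isGloballyMinimal` — the TYPE of the v25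
  proposals' bundle stub (`stub_galoisFormsAndNeronAtTwo` / `stub_galoisFormsAtTwo`) from T1⁺ alone;
* `exists_datum_odd_maninConstant_of_print hmod hΩu` — T4 from modularity and the plus period unit at `2` only;
* `lamLawDeltaPos_of_four_facts hBz hΩu hmod hJ` — the statement of `stub_lamLawDeltaPos` (R1) VERBATIM from FOUR tree-named PRINT facts (Buzzard 2000 Prop. 2.4,
  the plus period unit at `2`, modularity, T1⁺);
* `lamLawDeltaPos_of_conductorNorm_eq_of_four_facts hBz hΩu hmod hT1` — the equal-conductor twin (T1 `nonempty_modularJacobianGaloisData`).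

So, for the next lead: the `Δ(W₁) > 0` off-stratum residual of C1 rests on exactly {Buzzard 2.4, `Ω_E = u·Ω⁺_f` at `2`, modularity, T1⁺}; with the line's other
PRINT stubs (Kato 17.4, Matsuno 4.2, the minus period unit) and the Kilford residual R2 this is the whole list.

References: Silverman ATAEC IV.5–6, Cor. IV.9.1; Agashe–Ribet–Stein 2006 §§1–2; Buzzard 2000 Prop. 2.4; Greenberg–Vatsal 2000 Thm. (1.4); Abbes–Ullmo 1996 Thm. A;
Darmon–Diamond–Taylor 1995 §1.5–§1.7.
-/

noncomputable section

-- justification: the `Summit.BirchSwinnertonDyer.BirchSwinnertonDyer.…` path repeats a component (route-file convention)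
set_option linter.dupNamespace false
set_option autoImplicit false

open scoped MatrixGroups ModularForm NumberField Classical
open CongruenceSubgroup Complex WeierstrassCurve IsDedekindDomain Polynomial Module
open Literature.NumberTheory.EllipticCurves Literature.NumberTheory.EllipticCurves.ModularForms
open Literature.NumberTheory.EllipticCurves.Greenberg1999 Literature.NumberTheory.EllipticCurves.GreenbergVatsal2000
open Summit.BirchSwinnertonDyer.Rank1Residual.F1Sign2 Summit.BirchSwinnertonDyer.Rank1Residual.X1.MuLambda
open Summit.BirchSwinnertonDyer.BirchSwinnertonDyer.Theorems.AlignedTransportAtTwoDeltaPosOddManin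
open Summit.BirchSwinnertonDyer.BirchSwinnertonDyer.Theorems.AlignedTransportAtTwoSdFold

namespace Summit.BirchSwinnertonDyer.BirchSwinnertonDyer.Theorems.AlignedTransportAtTwoNeronFold

/-- **The v25 bundle «T1⁺ ∧ Néron scaling» from T1⁺ alone**: the TYPE of the (unregistered) v25 stub `stub_galoisFormsAndNeronAtTwo` / `stub_galoisFormsAtTwo`
(`nonempty_modularJacobianGaloisDataWithForms ∧ integral_neronScaling_of_isGloballyMinimal`), the second conjunct being the tree theorem
`integral_neronScaling_of_isGloballyMinimal_holds`. [cite: SilvermanATAEC1994, IV.5.1 with IV.6.1 and Cor. IV.9.1] [cite: DarmonDiamondTaylor1995, §1.5 and §1.7] -/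
theorem galoisFormsAndNeronAtTwo_of_forms (hJ : nonempty_modularJacobianGaloisDataWithForms) :
    nonempty_modularJacobianGaloisDataWithForms ∧ integral_neronScaling_of_isGloballyMinimal :=
  ⟨hJ, integral_neronScaling_of_isGloballyMinimal_holds⟩

/-- **T4 from TWO print facts** (modularity, the plus period unit at `2`): every globally minimal curve of the cell (good ordinary at `2`, no rational
`2`-torsion abscissa) has a parametrisation datum at its conductor level with ODD Manin constant — att-p4 g13's `exists_datum_odd_maninConstant` (p670841) with
the Néron-scaling input supplied by the tree theorem `integral_neronScaling_of_isGloballyMinimal_holds`.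
[cite: AbbesUllmo1996, Thm. A] [cite: AgasheRibetStein2006, §§1–2] [cite: SilvermanATAEC1994, IV.5.1 with IV.6.1 and Cor. IV.9.1] -/
theorem exists_datum_odd_maninConstant_of_print
    (hmod : exists_isNewformOf) (hΩu : realPeriodRat_eq_unit_mul_plusPeriod_two)
    (W : WeierstrassCurve ℚ) [W.IsElliptic] [W.IsGloballyMinimal] (hord : IsOrdinaryAt W 2) (ht : ∀ x : ℚ, ¬ HasRationalTwoTorsionX W x)
    [NeZero (W.conductorNorm ℤ)] :
    ∃ D : ModularParametrizationData W (W.conductorNorm ℤ), Odd D.c :=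
  exists_datum_odd_maninConstant hmod integral_neronScaling_of_isGloballyMinimal_holds hΩu W hord ht

/-- **(R1) `stub_lamLawDeltaPos` — its statement VERBATIM — from FOUR tree-named PRINT facts** (Buzzard's multiplicity one off the Kilford stratum, the plus
period unit at `2`, modularity, the `ℚ`-structure of `J₀(L)` with forms T1⁺): `…SdFold.lamLawDeltaPos_of_facts_of_bz` (p676260) with the Néron-scaling input
supplied by the tree theorem. [cite: GreenbergVatsal2000, Thm. (1.4) and §3] [cite: Buzzard2000LevelLoweringModTwo, Prop. 2.4]
[cite: DarmonDiamondTaylor1995, §1.5 and §1.7] [cite: AbbesUllmo1996, Thm. A] -/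
theorem lamLawDeltaPos_of_four_facts
    (hBz : buzzard2000_multiplicityOne_gamma0) (hΩu : realPeriodRat_eq_unit_mul_plusPeriod_two)
    (hmod : exists_isNewformOf) (hJ : nonempty_modularJacobianGaloisDataWithForms) :
    ∀ (W₁ : WeierstrassCurve ℚ) [W₁.IsElliptic] [W₁.IsGloballyMinimal]
      (W₂ : WeierstrassCurve ℚ) [W₂.IsElliptic] [W₂.IsGloballyMinimal],
      IsOrdinaryAt W₁ 2 → IsOrdinaryAt W₂ 2 →
      (∀ x : ℚ, ¬ HasRationalTwoTorsionX W₁ x) → (∀ x : ℚ, ¬ HasRationalTwoTorsionX W₂ x) →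
      ¬ IsSquare W₁.Δ → ¬ IsSquare W₂.Δ →
      (¬ ∃ (d : ℚ) (c : WeierstrassCurve.VariableChange ℚ), c • W₁.quadraticTwist d = W₂) →
      ¬ OnKilfordStratumAtTwo W₁ → 0 < W₁.Δ →
      ∀ (F : Type) [Field F] [NumberField F], Module.finrank ℚ F = 3 →
      ∀ e₁ e₂ : F, aeval e₁ (twoDivisionUCubic W₁) = 0 → aeval e₂ (twoDivisionUCubic W₂) = 0 →
      AlignedAtTwo F e₁ e₂ → AlignedAtInfinity F (twoDivisionUCubic W₁) (twoDivisionUCubic W₂) e₁ e₂ →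
      ∀ [NeZero (W₁.conductorNorm ℤ)] [NeZero (W₂.conductorNorm ℤ)]
        (f₁ : CuspForm (Gamma0 (W₁.conductorNorm ℤ)) 2), IsNewformOf W₁ f₁ →
      ∀ (f₂ : CuspForm (Gamma0 (W₂.conductorNorm ℤ)) 2), IsNewformOf W₂ f₂ →
      ∀ G₁ G₂ : IwasawaAlgebra 2, IsEvenBranchLiftAtTwo W₁ f₁ G₁ → IsEvenBranchLiftAtTwo W₂ f₂ G₂ →
        lam G₁ + ∑ ℓ ∈ (W₁.conductorNorm ℤ * W₂.conductorNorm ℤ).primeFactors.erase 2, lambdaCorrectionAtTwo W₁ ℓ =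
          lam G₂ + ∑ ℓ ∈ (W₁.conductorNorm ℤ * W₂.conductorNorm ℤ).primeFactors.erase 2, lambdaCorrectionAtTwo W₂ ℓ :=
  lamLawDeltaPos_of_facts_of_bz hBz hΩu hmod integral_neronScaling_of_isGloballyMinimal_holds hJ

/-- **The equal-conductor `λ`-law of the `Δ > 0` residual (R1) from FOUR named PRINT facts** (Buzzard 2.4, the plus period unit, modularity, T1
`nonempty_modularJacobianGaloisData`; any embedding `ι`): `…SdFold.lamLawDeltaPos_of_conductorNorm_eq_of_facts_of_bz` with the Néron-scaling input supplied by
the tree theorem. Conclusion = that of `stub_lamLawDeltaPos`. [cite: GreenbergVatsal2000, Thm. (1.4)] [cite: Buzzard2000LevelLoweringModTwo, Prop. 2.4]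
[cite: DarmonDiamondTaylor1995, §1.5 and §1.7] [cite: AbbesUllmo1996, Thm. A] -/
theorem lamLawDeltaPos_of_conductorNorm_eq_of_four_facts
    -- PRINT (all tree-named facts)
    (hBz : buzzard2000_multiplicityOne_gamma0) (hΩu : realPeriodRat_eq_unit_mul_plusPeriod_two)
    (hmod : exists_isNewformOf) (hT1 : nonempty_modularJacobianGaloisData)
    (ι : AlgebraicClosure ℚ →+* ℂ)
    -- the pair (binders of `stub_lamLawDeltaPos` that are used)
    (W₁ : WeierstrassCurve ℚ) [W₁.IsElliptic] [W₁.IsGloballyMinimal]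
    (W₂ : WeierstrassCurve ℚ) [W₂.IsElliptic] [W₂.IsGloballyMinimal]
    (hord₁ : IsOrdinaryAt W₁ 2) (hord₂ : IsOrdinaryAt W₂ 2)
    (ht₁ : ∀ x : ℚ, ¬ HasRationalTwoTorsionX W₁ x) (ht₂ : ∀ x : ℚ, ¬ HasRationalTwoTorsionX W₂ x)
    (hsq₂ : ¬ IsSquare W₂.Δ) (hK : ¬ OnKilfordStratumAtTwo W₁) (hΔ : 0 < W₁.Δ)
    {F : Type} [Field F] [NumberField F] (hF : finrank ℚ F = 3)
    {e₁ e₂ : F} (he₁ : aeval e₁ (twoDivisionUCubic W₁) = 0) (he₂ : aeval e₂ (twoDivisionUCubic W₂) = 0)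
    (hal : AlignedAtInfinity F (twoDivisionUCubic W₁) (twoDivisionUCubic W₂) e₁ e₂)
    [NeZero (W₁.conductorNorm ℤ)] [NeZero (W₂.conductorNorm ℤ)]
    {f₁ : CuspForm (Gamma0 (W₁.conductorNorm ℤ)) 2} (hf₁ : IsNewformOf W₁ f₁)
    {f₂ : CuspForm (Gamma0 (W₂.conductorNorm ℤ)) 2} (hf₂ : IsNewformOf W₂ f₂)
    {G₁ G₂ : IwasawaAlgebra 2} (hG₁ : IsEvenBranchLiftAtTwo W₁ f₁ G₁) (hG₂ : IsEvenBranchLiftAtTwo W₂ f₂ G₂)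
    -- EQUAL CONDUCTORS
    (hN : W₁.conductorNorm ℤ = W₂.conductorNorm ℤ) :
    lam G₁ + ∑ ℓ ∈ (W₁.conductorNorm ℤ * W₂.conductorNorm ℤ).primeFactors.erase 2, lambdaCorrectionAtTwo W₁ ℓ =
      lam G₂ + ∑ ℓ ∈ (W₁.conductorNorm ℤ * W₂.conductorNorm ℤ).primeFactors.erase 2, lambdaCorrectionAtTwo W₂ ℓ :=
  lamLawDeltaPos_of_conductorNorm_eq_of_facts_of_bz hBz hΩu hmod integral_neronScaling_of_isGloballyMinimal_holds hT1 ι W₁ W₂ hord₁ hord₂ ht₁ ht₂ hsq₂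
    hK hΔ hF he₁ he₂ hal hf₁ hf₂ hG₁ hG₂ hN

end Summit.BirchSwinnertonDyer.BirchSwinnertonDyer.Theorems.AlignedTransportAtTwoNeronFold

end
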